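import Summits.NavierStokesRegularity.NavierStokesRegularity.Theorems.TerminalTraceTypeITraceScarL3StubNoConfinedExtinctApex
import Literature.Analysis.FluidPDE.ESSLocalHolderNoConcentration
import Literature.Analysis.FluidPDE.TypeIRateOseenMildRepresentative
import Literature.Analysis.FluidPDE.OseenMildUniqueness
import Literature.Analysis.FluidPDE.LocalTypeI
import HarnessLib

/-!
# Depth vorticity rigidity for Type-I-bounded ancient flows — helper for item
# `TerminalTrace.TypeITraceScarL3` (stmt-NavierStokesRegularity-18385), stub QA of line `annulus-dichotomy`

Seat nsreg-C26-p1 (prover, cell ns-regularity-ideate), `--supports stmt-NavierStokesRegularity-18385`.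
Planner of record nsreg-p2 g28, ROUND-26 §1c, step (Q1) «centre concentration at depth»: the rigidity
half of the compactness–rigidity argument.

* `curl_slice_eq_zero_of_curl_eq_zero_on_ball` — UNIQUE CONTINUATION STEP.  A spatially smooth
  distributional Navier–Stokes solution `(V, P)` on a strip `]a, b[ × ℝ³` (jointly continuous, `C^∞`
  slices, all spatial derivatives jointly continuous) whose vorticity vanishes on a space–time box
  `]t₁, t₂[ × B(x₀, r)` has `curl V(t, ·) ≡ 0` on `ℝ³` for every `t ∈ ]t₁, t₂[`: the vorticity is of
  class `C¹ ∩ {∂ₓω ∈ C¹}` with `|∂ₜω − Δω| ≤ 2K(|ω| + |∇ω|)` on compact sub-boxes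
  (`vorticity_c12_of_isDistributionalNSSolutionOn`, `vorticity_carleman_inequality`), and the
  time-reversed translate `(s, y) ↦ ω(t − s, x₀ + y)` vanishes identically near the apex, so
  ESS 2003 Thm. 4.1 in that class (`Carleman.uniqueContinuation_uncurried_c12`) applies on every
  cylinder `]0, (t − t₁)/2[ × B(0, R)`.

WHAT THIS IS NOT: not Stub QA, not item 18385, no statement about Navier–Stokes regularity.
[folklore; EscauriazaSereginSverak2003 §3 and Thm. 4.1; Seregin2014 App. A.2]
-/

noncomputable section

set_option linter.dupNamespace false

namespace Summit.NavierStokesRegularity.NavierStokesRegularity.Theorems.TypeITraceScarL3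

open MeasureTheory Set Function Filter Topology TopologicalSpace Metric InnerProductSpace
open Literature.Analysis.FluidPDE
open scoped NNReal ENNReal RealInnerProductSpace Laplacian

/-! ### Unique continuation: vorticity vanishing on a box spreads to whole slices -/

/-- **Unique continuation step.**  Let `(V, P)` be a distributional Navier–Stokes solution (`ν = 1`)
on the strip `]a, b[ × ℝ³`, jointly continuous with `C^∞` slices and all spatial derivatives
jointly continuous.  If `curl V = 0` on a box `]t₁, t₂[ × B(x₀, r)` (`a ≤ t₁`, `t₂ ≤ b`, `r > 0`), then
`curl V(t, ·) = 0` on all of `ℝ³` for every `t ∈ ]t₁, t₂[` (ESS 2003, Thm. 4.1, in the class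
`C¹ ∩ {∂ₓω ∈ C¹}` of the vorticity: `Carleman.uniqueContinuation_uncurried_c12` applied to the
time-reversed translate of the vorticity, which vanishes identically near the apex).
[cite: EscauriazaSereginSverak2003, Thm. 4.1 and §3 (3.31)] -/
theorem curl_slice_eq_zero_of_curl_eq_zero_on_ball
    {a b : ℝ} {V : ℝ → EuclideanSpace ℝ (Fin 3) → EuclideanSpace ℝ (Fin 3)}
    {P : ℝ → EuclideanSpace ℝ (Fin 3) → ℝ}
    (hsol : IsDistributionalNSSolutionOn
      ⟨Ioo a b ×ˢ (univ : Set (EuclideanSpace ℝ (Fin 3))), isOpen_Ioo.prod isOpen_univ⟩ 1 0 V P)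
    (hVc : ContinuousOn (uncurry V) (Ioo a b ×ˢ (univ : Set (EuclideanSpace ℝ (Fin 3)))))
    (hCD : ∀ z ∈ Ioo a b ×ˢ (univ : Set (EuclideanSpace ℝ (Fin 3))), ContDiffAt ℝ (⊤ : ℕ∞) (V z.1) z.2)
    (hjc : ∀ n : ℕ, ContinuousOn
      (fun z : ℝ × EuclideanSpace ℝ (Fin 3) => iteratedFDeriv ℝ n (V z.1) z.2)
      (Ioo a b ×ˢ (univ : Set (EuclideanSpace ℝ (Fin 3)))))
    {t₁ t₂ : ℝ} (ht₁ : a ≤ t₁) (ht₂ : t₂ ≤ b) {x₀ : EuclideanSpace ℝ (Fin 3)} {r : ℝ} (hr : 0 < r)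
    (hcurl : ∀ z ∈ Ioo t₁ t₂ ×ˢ ball x₀ r, curl (V z.1) z.2 = 0) :
    ∀ t ∈ Ioo t₁ t₂, ∀ x : EuclideanSpace ℝ (Fin 3), curl (V t) x = 0 := by
  intro t ht x
  set I : Set ℝ := Ioo a b with hIdef
  have hIo : IsOpen I := isOpen_Ioo
  set Ω : Set (ℝ × EuclideanSpace ℝ (Fin 3)) := I ×ˢ (univ : Set (EuclideanSpace ℝ (Fin 3)))
    with hΩdef
  have hΩo : IsOpen Ω := hIo.prod isOpen_univ
  have htI : t ∈ I := ⟨lt_of_le_of_lt ht₁ ht.1, lt_of_lt_of_le ht.2 ht₂⟩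
  -- ### the class `C¹₂` of the vorticity on the whole strip
  have hU4 : ∀ s ∈ I, ContDiffOn ℝ 4 (V s) (univ : Set (EuclideanSpace ℝ (Fin 3))) :=
    fun s hs y _ => ((hCD (s, y) ⟨hs, mem_univ _⟩).of_le (by norm_cast)).contDiffWithinAt
  have hΦ : ∀ n ≤ 4, ContinuousOn
      (fun z : ℝ × EuclideanSpace ℝ (Fin 3) => iteratedFDeriv ℝ n (V z.1) z.2) Ω := fun n _ => hjc n
  obtain ⟨-, -, -, hω1, hωx⟩ :=
    vorticity_c12_of_isDistributionalNSSolutionOn hIo isOpen_univ hsol hU4 hΦ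
  -- ### the sub-box on which the Carleman inequality is used, with its bounds
  set a' : ℝ := (t + t₁) / 2 with ha'
  have ha'a : a < a' := by rw [ha']; linarith [ht.1]
  have ha't : a' < t := by rw [ha']; linarith [ht.1]
  set T' : ℝ := t - a' with hT'
  have hT'pos : 0 < T' := by rw [hT']; linarith
  -- target radius
  set Rb : ℝ := ‖x - x₀‖ + 1 with hRb
  have hRbpos : 0 < Rb := by positivity
  set R : ℝ := ‖x₀‖ + Rb + 1 with hR
  set I' : Set ℝ := Ioo a' t with hI'
  have hI'o : IsOpen I' := isOpen_Ioo
  set S' : Set (EuclideanSpace ℝ (Fin 3)) := ball (0 : EuclideanSpace ℝ (Fin 3)) R with hS'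
  have hS'o : IsOpen S' := isOpen_ball
  have hI'I : I' ⊆ I := fun s hs => ⟨ha'a.trans hs.1, hs.2.trans htI.2⟩
  have hsub' : I' ×ˢ S' ⊆ Ω := prod_mono hI'I (subset_univ _)
  -- compact closure inside the strip
  set Kc : Set (ℝ × EuclideanSpace ℝ (Fin 3)) :=
    Icc a' t ×ˢ closedBall (0 : EuclideanSpace ℝ (Fin 3)) R with hKc
  have hKcc : IsCompact Kc := isCompact_Icc.prod (isCompact_closedBall _ _)
  have hKcΩ : Kc ⊆ Ω := prod_mono (fun s hs => ⟨ha'a.trans_le hs.1, lt_of_le_of_lt hs.2 htI.2⟩)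
    (subset_univ _)
  have hI'S'Kc : I' ×ˢ S' ⊆ Kc := prod_mono Ioo_subset_Icc_self ball_subset_closedBall
  obtain ⟨K₀, hK₀'⟩ := hKcc.exists_bound_of_continuousOn (hVc.mono hKcΩ)
  obtain ⟨K₁, hK₁'⟩ := hKcc.exists_bound_of_continuousOn ((hjc 1).mono hKcΩ)
  set K : ℝ := max (max K₀ K₁) 0 with hKdef
  have hK0 : 0 ≤ K := le_max_right _ _
  have hK₀ : ∀ w ∈ I' ×ˢ S', ‖V w.1 w.2‖ ≤ K := fun w hw =>
    (hK₀' w (hI'S'Kc hw)).trans ((le_max_left _ _).trans (le_max_left _ _))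
  have hK₁ : ∀ w ∈ I' ×ˢ S', ‖fderiv ℝ (V w.1) w.2‖ ≤ K := fun w hw => by
    have h := hK₁' w (hI'S'Kc hw)
    rw [norm_iteratedFDeriv_one] at h
    exact h.trans ((le_max_right _ _).trans (le_max_left _ _))
  have hsol' : IsDistributionalNSSolutionOn ⟨I' ×ˢ S', hI'o.prod hS'o⟩ 1 0 V P :=
    hsol.of_le (fun w hw => hsub' hw)
  have hU4' : ∀ s ∈ I', ContDiffOn ℝ 4 (V s) S' := fun s hs => (hU4 s (hI'I hs)).mono (subset_univ _)
  have hΦ' : ∀ n ≤ 4, ContinuousOn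
      (fun z : ℝ × EuclideanSpace ℝ (Fin 3) => iteratedFDeriv ℝ n (V z.1) z.2) (I' ×ˢ S') :=
    fun n hn => (hΦ n hn).mono hsub'
  obtain ⟨-, -, hineq⟩ := vorticity_carleman_inequality hI'o hS'o hsol' hU4' hΦ' hK₀ hK₁
  -- bound on the vorticity on the sub-box
  have hωbd : ∀ z ∈ I' ×ˢ S', ‖(uncurry (vorticity V)) z‖ ≤ ‖curlCLM‖ * K := fun z hz => by
    show ‖vorticity V z.1 z.2‖ ≤ _
    rw [vorticity_apply]
    exact (norm_curl_le _ _).trans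
      (mul_le_mul_of_nonneg_left (hK₁ z hz) (ContinuousLinearMap.opNorm_nonneg curlCLM))
  -- ### the transported vorticity `u(s, y) = ω(t - s, x₀ + y)`
  set A : ℝ × EuclideanSpace ℝ (Fin 3) → ℝ × EuclideanSpace ℝ (Fin 3) := stAffine (-1) 1 t x₀
    with hAdef
  have hA1 : ∀ z : ℝ × EuclideanSpace ℝ (Fin 3), (A z).1 = t - z.1 := fun z => by
    show t + (-1) * z.1 = t - z.1; ring
  have hA2 : ∀ z : ℝ × EuclideanSpace ℝ (Fin 3), (A z).2 = x₀ + z.2 := fun z => by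
    show x₀ + (1 : ℝ) • z.2 = x₀ + z.2; rw [one_smul]
  set Q' : Set (ℝ × EuclideanSpace ℝ (Fin 3)) :=
    Ioo (0 : ℝ) T' ×ˢ ball (0 : EuclideanSpace ℝ (Fin 3)) Rb with hQ'
  have hAin : ∀ z ∈ Q', A z ∈ I' ×ˢ S' := by
    rintro ⟨s, y⟩ ⟨hs, hy⟩
    refine ⟨?_, ?_⟩
    · rw [hA1]
      have h1 := hs.1
      have h2 := hs.2
      simp only [hT'] at h2
      exact ⟨by simp only; linarith, by simp only; linarith⟩
    · rw [hA2, hS', mem_ball_zero_iff]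
      rw [mem_ball_zero_iff] at hy
      calc ‖x₀ + y‖ ≤ ‖x₀‖ + ‖y‖ := norm_add_le _ _
        _ < R := by rw [hR]; linarith
  have hAΩ' : ∀ z ∈ Ico (0 : ℝ) T' ×ˢ ball (0 : EuclideanSpace ℝ (Fin 3)) Rb, A z ∈ Ω := by
    rintro ⟨s, y⟩ ⟨hs, -⟩
    refine ⟨?_, mem_univ _⟩
    rw [hA1]
    have h1 := hs.1
    have h2 := hs.2
    simp only [hT'] at h2
    exact ⟨by simp only; linarith, by simp only; linarith [htI.2]⟩
  set ω : ℝ × EuclideanSpace ℝ (Fin 3) → EuclideanSpace ℝ (Fin 3) := uncurry (vorticity V) with hωdef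
  set u : ℝ × EuclideanSpace ℝ (Fin 3) → EuclideanSpace ℝ (Fin 3) := fun z => ω (A z) with hudef
  have hu1 : ContDiffOn ℝ 1 u Q' :=
    (Carleman.contDiffOn_comp_stAffine hω1 (-1) 1 t x₀).mono fun z hz => hsub' (hAin z hz)
  have hdxu : ∀ e : EuclideanSpace ℝ (Fin 3), Carleman.dx e u = fun z => Carleman.dx e ω (A z) := by
    intro e
    funext z
    rw [hudef, Carleman.dx_comp_stAffine (by norm_num) one_ne_zero ω e z, one_smul]
  have hux : ∀ e : EuclideanSpace ℝ (Fin 3), ContDiffOn ℝ 1 (Carleman.dx e u) Q' := by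
    intro e
    rw [hdxu e]
    exact (Carleman.contDiffOn_comp_stAffine (hωx e) (-1) 1 t x₀).mono fun z hz => hsub' (hAin z hz)
  have hucont : ContinuousOn u (Ico (0 : ℝ) T' ×ˢ ball (0 : EuclideanSpace ℝ (Fin 3)) Rb) :=
    (Carleman.continuousOn_comp_stAffine hω1.continuousOn (-1) 1 t x₀).mono fun z hz => hAΩ' z hz
  have hdtu : ∀ z, Carleman.dt u z = (-1 : ℝ) • Carleman.dt ω (A z) := fun z => by
    rw [hudef, Carleman.dt_comp_stAffine (by norm_num) one_ne_zero]
  have hlapu : ∀ z, Carleman.lap u z = Carleman.lap ω (A z) := fun z => by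
    rw [hudef, Carleman.lap_comp_stAffine (by norm_num) one_ne_zero, one_pow, one_smul]
  have hgradu : ∀ z, Carleman.gradSq u z = Carleman.gradSq ω (A z) := fun z => by
    rw [hudef, Carleman.gradSq_comp_stAffine (by norm_num) one_ne_zero, one_pow, one_mul]
  have hinequ : ∀ z ∈ Q', ‖Carleman.dt u z + Carleman.lap u z‖ ≤
      (K + K) * (‖u z‖ + Real.sqrt (Carleman.gradSq u z)) := by
    intro z hz
    rw [hdtu z, hlapu z, hgradu z]
    have e1 : (-1 : ℝ) • Carleman.dt ω (A z) + Carleman.lap ω (A z) =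
        -(Carleman.dt ω (A z) - Carleman.lap ω (A z)) := by
      rw [neg_one_smul]; abel
    rw [e1, norm_neg]
    exact hineq (A z) (hAin z hz)
  -- the transported vorticity vanishes identically near the apex
  have hvan0 : ∀ z ∈ Q', ‖z.2‖ < r → u z = 0 := by
    rintro ⟨s, y⟩ hz hy
    have hmem : A (s, y) ∈ Ioo t₁ t₂ ×ˢ ball x₀ r := by
      refine ⟨?_, ?_⟩
      · rw [hA1]
        have h1 := hz.1.1
        have h2 := hz.1.2
        simp only [hT', ha'] at h2
        refine ⟨by simp only; linarith, by simp only; linarith [ht.2]⟩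
      · rw [hA2, mem_ball, dist_eq_norm, add_sub_cancel_left]
        exact hy
    have h := hcurl (A (s, y)) hmem
    show vorticity V (A (s, y)).1 (A (s, y)).2 = 0
    rw [vorticity_apply]
    exact h
  have hvan : ∀ k : ℕ, ∃ C : ℝ, ∀ z ∈ Q', ‖u z‖ ≤ C * (‖z.2‖ + Real.sqrt z.1) ^ k := by
    intro k
    refine ⟨‖curlCLM‖ * K / r ^ k, fun z hz => ?_⟩
    have hbase : 0 ≤ ‖z.2‖ + Real.sqrt z.1 := by positivity
    by_cases hy : ‖z.2‖ < r
    · rw [hvan0 z hz hy, norm_zero]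
      positivity
    · push Not at hy
      have h1 : r ^ k ≤ (‖z.2‖ + Real.sqrt z.1) ^ k :=
        pow_le_pow_left₀ hr.le (hy.trans (by linarith [Real.sqrt_nonneg z.1])) k
      have hrk : 0 < r ^ k := pow_pos hr k
      calc ‖u z‖ = ‖ω (A z)‖ := rfl
        _ ≤ ‖curlCLM‖ * K := hωbd _ (hAin z hz)
        _ = ‖curlCLM‖ * K / r ^ k * r ^ k := by field_simp
        _ ≤ ‖curlCLM‖ * K / r ^ k * (‖z.2‖ + Real.sqrt z.1) ^ k :=
            mul_le_mul_of_nonneg_left h1 (by positivity)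
  have huc := Carleman.uniqueContinuation_uncurried_c12 3 3 (c₁ := K + K) (R := Rb) (T := T')
    (by positivity) hRbpos hT'pos hu1 hux hucont hinequ hvan
  -- ### evaluate at `y = x - x₀`
  have hy : x - x₀ ∈ ball (0 : EuclideanSpace ℝ (Fin 3)) Rb := by
    rw [mem_ball_zero_iff, hRb]; linarith
  have h := huc (x - x₀) hy
  have hA0 : A (0, x - x₀) = (t, x) := by
    show (t + (-1) * (0 : ℝ), x₀ + (1 : ℝ) • (x - x₀)) = (t, x)
    simp
  have h' : ω (A (0, x - x₀)) = 0 := h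
  rw [hA0] at h'
  have h'' : vorticity V t x = 0 := h'
  rwa [vorticity_apply] at h''

/-! ### Liouville: the velocity vanishes a.e. on the slab where the vorticity vanishes -/

/-- **Depth rigidity, slab form.**  Let `u` be a field on the backward slab with Albritton–Barker
bound `𝐈(ℝ³ × ℝ₋) ≤ I` (through a pressure `p` and a weak gradient `H`), essentially bounded by `L`
on a strip `]a, b[ × ℝ³`, `b ≤ 0`, and let `(V, P)` be a spatially smooth distributional
Navier–Stokes representative of `u` on that strip (jointly continuous, `C^∞` slices, all spatial
derivatives jointly continuous, `V = u` a.e.).  If `curl V = 0` on a box `]t₁, t₂[ × B(x₀, r)`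
(`a ≤ t₁`, `t₂ ≤ b`, `r > 0`), then `u = 0` a.e. on `]t₁, t₂[ × ℝ³`: by unique continuation
(`curl_slice_eq_zero_of_curl_eq_zero_on_ball`) every slice `V(t)`, `t ∈ ]t₁, t₂[`, is irrotational
and divergence free, hence harmonic (`laplacian_eq_zero_of_curl_eq_zero_of_isDivFree`); at a.e. `t`
it is a.e. bounded with ball energies `∫_{B_n} |u(t)|² ≤ I n` (the `A`-part of `𝐈`,
`ae_lintegral_ball_sq_le_of_typeIBound`), so it vanishes
(`harmonic_eq_zero_of_ae_bounded_of_energy_growth`). [folklore; EscauriazaSereginSverak2003 §3;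
KochNadirashviliSereginSverak2009 §1] -/
theorem slab_ae_zero_of_curl_eq_zero_on_ball
    {u : ℝ → EuclideanSpace ℝ (Fin 3) → EuclideanSpace ℝ (Fin 3)}
    {p : ℝ → EuclideanSpace ℝ (Fin 3) → ℝ}
    {H : ℝ → EuclideanSpace ℝ (Fin 3) → EuclideanSpace ℝ (Fin 3) →L[ℝ] EuclideanSpace ℝ (Fin 3)}
    {I : ℝ} (hI : typeIBound (Iio (0 : ℝ) ×ˢ (univ : Set (EuclideanSpace ℝ (Fin 3)))) u p H ≤
      ENNReal.ofReal I)
    {a b : ℝ} (hb : b ≤ 0) {L : ℝ}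
    (hL : ∀ᵐ z ∂(volume.restrict (Ioo a b ×ˢ (univ : Set (EuclideanSpace ℝ (Fin 3))))),
      ‖u z.1 z.2‖ ≤ L)
    {V : ℝ → EuclideanSpace ℝ (Fin 3) → EuclideanSpace ℝ (Fin 3)}
    {P : ℝ → EuclideanSpace ℝ (Fin 3) → ℝ}
    (hsol : IsDistributionalNSSolutionOn
      ⟨Ioo a b ×ˢ (univ : Set (EuclideanSpace ℝ (Fin 3))), isOpen_Ioo.prod isOpen_univ⟩ 1 0 V P)
    (hVu : uncurry V =ᵐ[volume.restrict (Ioo a b ×ˢ (univ : Set (EuclideanSpace ℝ (Fin 3))))]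
      uncurry u)
    (hVc : ContinuousOn (uncurry V) (Ioo a b ×ˢ (univ : Set (EuclideanSpace ℝ (Fin 3)))))
    (hCD : ∀ z ∈ Ioo a b ×ˢ (univ : Set (EuclideanSpace ℝ (Fin 3))), ContDiffAt ℝ (⊤ : ℕ∞) (V z.1) z.2)
    (hjc : ∀ n : ℕ, ContinuousOn
      (fun z : ℝ × EuclideanSpace ℝ (Fin 3) => iteratedFDeriv ℝ n (V z.1) z.2)
      (Ioo a b ×ˢ (univ : Set (EuclideanSpace ℝ (Fin 3)))))
    {t₁ t₂ : ℝ} (ht₁ : a ≤ t₁) (ht₂ : t₂ ≤ b) {x₀ : EuclideanSpace ℝ (Fin 3)} {r : ℝ} (hr : 0 < r)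
    (hcurl : ∀ z ∈ Ioo t₁ t₂ ×ˢ ball x₀ r, curl (V z.1) z.2 = 0) :
    (∀ᵐ t ∂(volume.restrict (Ioo t₁ t₂)), V t = 0) ∧
    ∀ᵐ z ∂(volume.restrict (Ioo t₁ t₂ ×ˢ (univ : Set (EuclideanSpace ℝ (Fin 3))))),
      uncurry u z = 0 := by
  set I₀ : Set ℝ := Ioo a b with hI₀def
  have hI₀o : IsOpen I₀ := isOpen_Ioo
  set Ω : Set (ℝ × EuclideanSpace ℝ (Fin 3)) := I₀ ×ˢ (univ : Set (EuclideanSpace ℝ (Fin 3)))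
    with hΩdef
  have h12I : Ioo t₁ t₂ ⊆ I₀ := fun s hs => ⟨lt_of_le_of_lt ht₁ hs.1, lt_of_lt_of_le hs.2 ht₂⟩
  -- ### every slice in the window is irrotational, divergence free, hence harmonic
  have hω0 := curl_slice_eq_zero_of_curl_eq_zero_on_ball hsol hVc hCD hjc ht₁ ht₂ hr hcurl
  have hU4 : ∀ s ∈ I₀, ContDiffOn ℝ 4 (V s) (univ : Set (EuclideanSpace ℝ (Fin 3))) :=
    fun s hs y _ => ((hCD (s, y) ⟨hs, mem_univ _⟩).of_le (by norm_cast)).contDiffWithinAt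
  have hΦ : ∀ n ≤ 4, ContinuousOn
      (fun z : ℝ × EuclideanSpace ℝ (Fin 3) => iteratedFDeriv ℝ n (V z.1) z.2) Ω := fun n _ => hjc n
  obtain ⟨hdiv, -, -, -, -⟩ :=
    vorticity_c12_of_isDistributionalNSSolutionOn hI₀o isOpen_univ hsol hU4 hΦ
  have hharm : ∀ t ∈ Ioo t₁ t₂,
      InnerProductSpace.HarmonicOnNhd (V t) (univ : Set (EuclideanSpace ℝ (Fin 3))) := by
    intro t ht x _
    have htI : t ∈ I₀ := h12I ht
    have hcd : ContDiff ℝ 2 (V t) := contDiff_iff_contDiffAt.2 fun y =>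
      (hCD (t, y) ⟨htI, mem_univ _⟩).of_le (by norm_cast)
    have hΔ : ∀ y, Δ (V t) y = 0 :=
      laplacian_eq_zero_of_curl_eq_zero_of_isDivFree hcd (hω0 t ht)
        (fun y => hdiv (t, y) ⟨htI, mem_univ _⟩)
    show InnerProductSpace.HarmonicAt (V t) x
    constructor
    · exact hcd.contDiffAt
    · exact Filter.Eventually.of_forall fun y => by rw [Pi.zero_apply]; exact hΔ y
  -- ### Fubini: a.e. slice, `V(t) = u(t)` a.e. and `|u(t)| ≤ L` a.e.
  have hslice : ∀ᵐ t ∂(volume.restrict I₀), V t =ᵐ[volume] u t := by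
    have h1 : ∀ᵐ z ∂((volume.restrict I₀).prod (volume : Measure (EuclideanSpace ℝ (Fin 3)))),
        uncurry V z = uncurry u z := by
      rw [Measure.restrict_prod_eq_prod_univ, ← Measure.volume_eq_prod]
      exact hVu
    filter_upwards [Measure.ae_ae_of_ae_prod h1] with t ht
    filter_upwards [ht] with x hx
    exact hx
  set L' : ℝ := max L 0 with hL'
  have hLslice : ∀ᵐ t ∂(volume.restrict I₀),
      ∀ᵐ y ∂(volume : Measure (EuclideanSpace ℝ (Fin 3))), ‖u t y‖ ≤ L' := by
    have h1 : ∀ᵐ z ∂((volume.restrict I₀).prod (volume : Measure (EuclideanSpace ℝ (Fin 3)))),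
        ‖u z.1 z.2‖ ≤ L' := by
      rw [Measure.restrict_prod_eq_prod_univ, ← Measure.volume_eq_prod]
      exact hL.mono fun z hz => hz.trans (le_max_left _ _)
    filter_upwards [Measure.ae_ae_of_ae_prod h1] with t ht
    exact ht
  -- ### the ball energies at a.e. time of the window
  set I' : ℝ := max I 0 with hI'
  have hI'0 : 0 ≤ I' := le_max_right _ _
  have hIle' : typeIBound (Iio (0 : ℝ) ×ˢ (univ : Set (EuclideanSpace ℝ (Fin 3)))) u p H ≤
      ENNReal.ofReal I' := hI.trans (ENNReal.ofReal_le_ofReal (le_max_left _ _))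
  obtain ⟨N₀, hN₀⟩ := exists_nat_ge (max 1 (-t₁))
  have hN₀1 : (1 : ℝ) ≤ N₀ := (le_max_left _ _).trans hN₀
  have hN₀t : -t₁ ≤ N₀ := (le_max_right _ _).trans hN₀
  have hlarge : ∀ᵐ t ∂(volume.restrict (Ioo t₁ t₂)), ∀ n : ℕ, N₀ ≤ n →
      ∫⁻ y in ball (0 : EuclideanSpace ℝ (Fin 3)) n, ‖u t y‖ₑ ^ 2 ≤
        ENNReal.ofReal I' * (n : ℝ≥0∞) := by
    rw [ae_all_iff]
    intro n
    by_cases hn : N₀ ≤ n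
    · have hn' : (N₀ : ℝ) ≤ n := by exact_mod_cast hn
      have hnpos : (0 : ℝ) < n := by linarith
      have hsub : Ioo t₁ t₂ ⊆ Ioo (-(n : ℝ) ^ 2) 0 := fun s hs =>
        ⟨by nlinarith [hs.1], lt_of_lt_of_le hs.2 (ht₂.trans hb)⟩
      have h := ae_restrict_of_ae_restrict_of_subset hsub
        (ae_lintegral_ball_sq_le_of_typeIBound hIle' hnpos)
      filter_upwards [h] with t ht _
      rw [ENNReal.ofReal_mul hI'0, ENNReal.ofReal_natCast] at ht
      exact ht
    · exact Eventually.of_forall fun t h => absurd h hn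
  set C₀ : ℝ≥0∞ := ENNReal.ofReal (L' ^ 2) * volume (ball (0 : EuclideanSpace ℝ (Fin 3)) N₀)
    with hC₀
  have hC₀top : C₀ ≠ ⊤ := ENNReal.mul_ne_top ENNReal.ofReal_ne_top measure_ball_lt_top.ne
  have hsmall : ∀ᵐ t ∂(volume.restrict (Ioo t₁ t₂)), ∀ n : ℕ, n ≤ N₀ →
      ∫⁻ y in ball (0 : EuclideanSpace ℝ (Fin 3)) n, ‖u t y‖ₑ ^ 2 ≤ C₀ := by
    filter_upwards [ae_restrict_of_ae_restrict_of_subset h12I hLslice] with t ht n hn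
    calc ∫⁻ y in ball (0 : EuclideanSpace ℝ (Fin 3)) n, ‖u t y‖ₑ ^ 2
        ≤ ∫⁻ y in ball (0 : EuclideanSpace ℝ (Fin 3)) n, ENNReal.ofReal (L' ^ 2) := by
          refine lintegral_mono_ae (ae_restrict_of_ae (ht.mono fun y hy => ?_))
          rw [← ofReal_norm, ← ENNReal.ofReal_pow (norm_nonneg _)]
          exact ENNReal.ofReal_le_ofReal
            (pow_le_pow_left₀ (norm_nonneg _) hy 2)
      _ = ENNReal.ofReal (L' ^ 2) * volume (ball (0 : EuclideanSpace ℝ (Fin 3)) n) := by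
          rw [lintegral_const, Measure.restrict_apply_univ]
      _ ≤ C₀ := by
          rw [hC₀]
          gcongr
  set M' : ℝ≥0∞ := ENNReal.ofReal I' + C₀ with hM'
  have hM'top : M' ≠ ⊤ := ENNReal.add_ne_top.2 ⟨ENNReal.ofReal_ne_top, hC₀top⟩
  have hgrowth : ∀ᵐ t ∂(volume.restrict (Ioo t₁ t₂)), ∀ n : ℕ, 1 ≤ n →
      ∫⁻ y in ball (0 : EuclideanSpace ℝ (Fin 3)) n, ‖u t y‖ₑ ^ 2 ≤ M' * (n : ℝ≥0∞) := by
    filter_upwards [hlarge, hsmall] with t h1 h2 n hn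
    have hn1 : (1 : ℝ≥0∞) ≤ n := by exact_mod_cast hn
    by_cases hN : N₀ ≤ n
    · calc ∫⁻ y in ball (0 : EuclideanSpace ℝ (Fin 3)) n, ‖u t y‖ₑ ^ 2
          ≤ ENNReal.ofReal I' * (n : ℝ≥0∞) := h1 n hN
        _ ≤ M' * (n : ℝ≥0∞) := by rw [hM']; gcongr; exact le_self_add
    · push Not at hN
      calc ∫⁻ y in ball (0 : EuclideanSpace ℝ (Fin 3)) n, ‖u t y‖ₑ ^ 2 ≤ C₀ := h2 n hN.le
        _ ≤ C₀ * (n : ℝ≥0∞) := le_mul_of_one_le_right bot_le hn1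
        _ ≤ M' * (n : ℝ≥0∞) := by rw [hM']; gcongr; exact le_add_self
  -- ### Liouville at a.e. time
  have hVzero : ∀ᵐ t ∂(volume.restrict (Ioo t₁ t₂)), V t = 0 := by
    filter_upwards [ae_restrict_mem measurableSet_Ioo,
      ae_restrict_of_ae_restrict_of_subset h12I hslice,
      ae_restrict_of_ae_restrict_of_subset h12I hLslice, hgrowth] with t ht hVt hLt hgt
    exact harmonic_eq_zero_of_ae_bounded_of_energy_growth (hharm t ht) hVt hLt hM'top hgt
  refine ⟨hVzero, ?_⟩
  -- ### the product form
  set S : Set ℝ := {t | V t = 0} with hS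
  have hnull : volume (Ioo t₁ t₂ ∩ Sᶜ) = 0 := by
    have h := (ae_restrict_iff' measurableSet_Ioo).1 hVzero
    rw [ae_iff] at h
    refine measure_mono_null (fun t ht => ?_) h
    exact fun himp => ht.2 (himp ht.1)
  have hVprod : ∀ᵐ z ∂(volume.restrict (Ioo t₁ t₂ ×ˢ (univ : Set (EuclideanSpace ℝ (Fin 3))))),
      uncurry V z = 0 := by
    rw [ae_restrict_iff' (measurableSet_Ioo.prod MeasurableSet.univ), ae_iff]
    refine measure_mono_null (fun z hz => ?_) ?_ (t := (Ioo t₁ t₂ ∩ Sᶜ) ×ˢ univ)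
    · rw [mem_setOf_eq, Classical.not_imp] at hz
      refine ⟨⟨hz.1.1, fun hS0 => hz.2 ?_⟩, mem_univ _⟩
      show V z.1 z.2 = 0
      rw [show V z.1 = 0 from hS0, Pi.zero_apply]
    · rw [Measure.volume_eq_prod, Measure.prod_prod, hnull, zero_mul]
  have hVu' : uncurry V =ᵐ[volume.restrict (Ioo t₁ t₂ ×ˢ (univ : Set (EuclideanSpace ℝ (Fin 3))))]
      uncurry u := ae_restrict_of_ae_restrict_of_subset (prod_mono h12I Subset.rfl) hVu
  filter_upwards [hVprod, hVu'] with z h1 h2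
  rw [← h2, h1]

end Summit.NavierStokesRegularity.NavierStokesRegularity.Theorems.TypeITraceScarL3

end
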